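import Literature.Probability.Percolation.Percolation
import Literature.Probability.LatticeModels.IsoradialPercolation
import HarnessLib

/-!
# Gladkov's three-cluster `ε`–`δ` dichotomy (Gladkov 2024, Thm. 1.3, formerly GZ24 §6.2)

Topic `Literature/Probability/Percolation`. Source: N. Gladkov, *Percolation Inequalities and
Decision Trees*, arXiv:2408.08457v2 (2024) [Gladkov2024]; read in the arXiv version (`lit read
paper:arxiv-2408.08457`): §1 p. 2 (standing assumptions, Lemma 1.2, **Theorem 1.3**), §2 p. 3
(Def. 2.1, the events `abc`, `a|b|c`, `ab|c`), §7 pp. 11–12 (proofs of Lemma 1.2 and Thm. 1.3),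
§10 p. 18 (the stronger statement 10.1, left unsettled there).

**Printed statement.** Standing assumptions (p. 1, end of the §1 preamble): "let `G = (V, E)` be a
locally finite connected simple graph and `P` is the probability in a Bernoulli bond percolation
model where each edge `e ∈ E` is assigned a probability `p_e` of being open"; §2 (p. 3): "We also
assume that `a, b, c, d ∈ V` are distinct vertices of `G`."  *Definition 2.1* (p. 3): "`P(abc)`
denotes the probability that vertices `a, b, c ∈ V` lie in the same cluster, and `P(a|b|c)` is the
probability that `a, b` and `c` belong to 3 different clusters."  **Theorem 1.3** (p. 2): "For
`ε > 0`, there exists `δ > 0`, such that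
`[P(ab|c) < δ and P(ac|b) < δ] ⟹ [P(abc) < ε or P(a|b|c) < ε]`,
where `P(a|b|c)` is the probability that `a, b` and `c` are in three different clusters, `P(abc)`
is the probability that `a, b` and `c` are in the same cluster, `P(ab|c)` is the probability that
`a` and `b` are in the same cluster different from the cluster of `c` and `P(ac|b)` is the
probability that `a` and `c` are in the same cluster different from the cluster of `b`."
Proof (§7.2, p. 12): from **Lemma 1.2** (p. 2), "For vertices `a, b` and `c` in `G` one has
`P(a|b|c) + P(a|b ∪ a|c)² ≥ P(a|b|c)²/P(a|b ∪ b|c) + P(a|b|c)²/P(a|c ∪ b|c)` (2)", by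
interchanging `a` and `b` and elementary estimates: "`4δ ≥ … ≥ ε³`. Now we see that `δ < ε³/4`
contradicts Lemma 1.2, thus proving" the theorem — so `δ` depends on `ε` only (any
`δ < ε³/4`), uniformly in the graph and the weights; Lemma 1.2 itself rests on GZ24's Lemma 7.1
(three depth-first decision trees with mixed `S`/`S̄` decisions) and the Cauchy–Schwarz bound
Thm. 5.2.

## Transcription notes

* *Percolation model.* Vendored for the tree's INHOMOGENEOUS product measure `prodBernoulli w`
  (`IsoradialPercolation.lean`) of a weight function `w : Sym2 V → [0,1]` on a FINITE vertex type
  `V` — the printed model on the (locally finite, connected, simple) complete graph on `V` with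
  `p_e = w e` (pairs of weight `0` are a.s. closed; loops are ignored by `openGraph`); this is the
  setting of Kozma–Nitzan's Conjecture 3 (`KozmaNitzanReduction.lean`) and of the route
  `PercNearOneGluing`, and a special case of print (finite `G`; "For infinite `G`, the theorem
  follows by passing to the limit", p. 12), so the vendored statement is never stronger than print.
* *Events* (Def. 2.1) with `{x ↔ y} = openConn x y`: `abc = {a↔b} ∩ {a↔c}`;
  `a|b|c = {a↔b}ᶜ ∩ {a↔c}ᶜ ∩ {b↔c}ᶜ`; `ab|c = {a↔b} ∩ {a↔c}ᶜ`; `ac|b = {a↔c} ∩ {a↔b}ᶜ`.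
* *Quantifiers.* `δ` is chosen from `ε` alone, before the graph (the printed proof gives every
  `δ < ε³/4`); distinctness of `a, b, c` is kept as printed (§2).
* Not vendored: Lemma 1.2 (the asymmetric inequality (2)), statement 10.1 (p. 18, not settled in
  print), the bound `α₃ ≤ 0.356` (§7.3). Theorem 1.1 is `gladkov2024_thm_6_2` (proved,
  `GladkovThreePointBoundProofs.lean`); the decision-tree HK / vdBK / Cauchy–Schwarz inequalities
  (Thms. 3.2, 4.3, 5.2) are proved in `DecisionTreeWeighted.lean`.
* `lean search 'gladkov2024|three.?cluster|dichotomy'`: no prior transcription of Thm. 1.3.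

This is the ONLY proved `ε`–`δ` connectivity statement on general graphs of the genre of
Kozma–Nitzan's Conjecture 3 found in print (three points, no relay set); it is cited by the route
`PercNearOneGluing` (cruxes `NearOneGluing`, `NoHeavyLowerTail`) as nearest prior art.

## References

* N. Gladkov, *Percolation Inequalities and Decision Trees*, arXiv:2408.08457v2 (2024): Lemma 1.2
  and Thm. 1.3 (p. 2), Def. 2.1 (p. 3), §7 (pp. 11–12), §10 (p. 18). [Gladkov2024]
* N. Gladkov, A. Zimin, *Bond percolation does not simulate site percolation*, arXiv:2404.08873,
  Electron. Commun. Probab. (2026), doi:10.1214/26-ecp760, §6.2 (where the statement was posed).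
  [GladkovZimin2024]
-/

noncomputable section

namespace Literature.Probability.Percolation

open MeasureTheory Literature.Probability.LatticeModels

/-- **Gladkov 2024, Theorem 1.3 — the three-cluster `ε`–`δ` dichotomy** (arXiv:2408.08457, p. 2;
proof §7.2, p. 12; the statement was posed as GZ24 §6.2 and is PROVED in this source): for every
`ε > 0` there is `δ > 0` such that for Bernoulli bond percolation with arbitrary edge probabilities
and distinct vertices `a, b, c`, if `P(ab|c) < δ` and `P(ac|b) < δ` then `P(abc) < ε` or
`P(a|b|c) < ε` — "it is impossible for three vertices `a, b, c` to be in the same cluster with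
probability `0 < p < 1` and in three different clusters with probability `1 − p − ε` for small
enough `ε`" (p. 1).  Recorded for the product measure `prodBernoulli w` of a weight function on a
finite vertex type (special case of print), events via `openConn` (Def. 2.1):
`abc = {a↔b} ∩ {a↔c}`, `ab|c = {a↔b} ∩ {a↔c}ᶜ`, `ac|b = {a↔c} ∩ {a↔b}ᶜ`,
`a|b|c = {a↔b}ᶜ ∩ {a↔c}ᶜ ∩ {b↔c}ᶜ`; `δ` depends on `ε` only (the printed proof gives any
`δ < ε³/4`).  Users take `(h : gladkov2024_thm_1_3)`.
[cite: Gladkov2024, Thm. 1.3 (p. 2), proof §7.2 (p. 12), arXiv:2408.08457] -/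
def gladkov2024_thm_1_3 : Prop :=
  ∀ ε : ℝ, 0 < ε → ∃ δ : ℝ, 0 < δ ∧
    ∀ (V : Type) [Fintype V] (w : Sym2 V → unitInterval) (a b c : V), a ≠ b → a ≠ c → b ≠ c →
      (prodBernoulli w).real (openConn a b ∩ (openConn a c)ᶜ) < δ →
      (prodBernoulli w).real (openConn a c ∩ (openConn a b)ᶜ) < δ →
        (prodBernoulli w).real (openConn a b ∩ openConn a c) < ε ∨
          (prodBernoulli w).real ((openConn a b)ᶜ ∩ (openConn a c)ᶜ ∩ (openConn b c)ᶜ) < ε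

/-- **Contrapositive, quantitative reading used in gluing arguments**: if three distinct vertices are
all in one cluster with probability `≥ ε` and pairwise separated with probability `≥ ε`, then one of
the two "two against one" events `ab|c`, `ac|b` has probability `≥ δ(ε)`.
[cite: Gladkov2024, Thm. 1.3 (p. 2)] -/
theorem gladkov2024_thm_1_3.le_max (h : gladkov2024_thm_1_3) {ε : ℝ} (hε : 0 < ε) :
    ∃ δ : ℝ, 0 < δ ∧ ∀ (V : Type) [Fintype V] (w : Sym2 V → unitInterval) (a b c : V),
      a ≠ b → a ≠ c → b ≠ c →
      ε ≤ (prodBernoulli w).real (openConn a b ∩ openConn a c) →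
      ε ≤ (prodBernoulli w).real ((openConn a b)ᶜ ∩ (openConn a c)ᶜ ∩ (openConn b c)ᶜ) →
        δ ≤ max ((prodBernoulli w).real (openConn a b ∩ (openConn a c)ᶜ))
          ((prodBernoulli w).real (openConn a c ∩ (openConn a b)ᶜ)) := by
  obtain ⟨δ, hδ, H⟩ := h ε hε
  refine ⟨δ, hδ, fun V _ w a b c hab hac hbc h1 h2 => ?_⟩
  by_contra hlt
  rw [not_le, max_lt_iff] at hlt
  rcases H V w a b c hab hac hbc hlt.1 hlt.2 with h' | h'
  · exact absurd h1 (not_le.2 h')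
  · exact absurd h2 (not_le.2 h')

end Literature.Probability.Percolation

end
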